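import Summits.CriticalPhenomena.PercolationContinuityZ3.Theorems.PercNearOneGluingNoHeavyLowerTailSahiDeepCoreTransitions
import Mathlib.Tactic.Linarith
import Mathlib.Tactic.Ring
import HarnessLib

/-!
# `NoHeavyLowerTail` (crux stmt-CriticalPhenomena-4575), master-family line P1: the one-coordinate bracket in TRANSITION CELLS —
# `β_e = β'_e + Σ_k (static mass of petal k)·Δ_iΔ_j` with `β'_e ≥ 0`; a coordinate at which no petal has static mass is GOOD

Support file (seat `prim-masterthm-p1`, gen 10; `--supports stmt-CriticalPhenomena-4575`).  No definition, no `sorry`, standard axioms.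
Memo `run/shared/lean/prim/prim-masterthm/FROM-prim-masterthm-p1-g10-DEEP-CORE.md` §0/§4; companion of `…SahiDeepCoreEGC` (`egcBracket`,
`ExistsGoodCoordinateS3`, `classLaw_of_EGC`).

SETTING.  Sandwiched increasing triple `(A, B, N)`; cells `P = A∖B`, `Q = B∖A`, `K = A∩B∩N`, `Dₙ = (A∩B)∖N`, `O = (A∪B)ᶜ`; coordinate `e`,
sections `X⁰ = X^{e←0}`, `X¹ = X^{e←1}`.  Because `K`, `K∪P = A∩N`, `K∪Q = B∩N`, `K∪Dₙ = A∩B` are increasing and `O` is decreasing, raising `e`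
can only move a configuration `O → anything`, `petal → same petal or K`, `K → K` (Gladkov's transition cells).  TRANSITION MASSES at `e`
(all `μ_p` of intersections of sections): `cp_X = μ(X⁰∩K¹)` (petal `X` → core), `cm_X = μ(O⁰∩X¹)` (outside → petal `X`), `cs_X = μ(X⁰∩X¹)`
(static), `d = μ(O⁰∩K¹)`.  BOOKKEEPING (sibling file `…SahiDeepCoreTransitions`: `petal_section_false/true`, `core_section_true`, `outside_section_false`):
`μX⁰ = cs_X + cp_X`, `μX¹ = cs_X + cm_X`, `μK¹ = μK⁰ + d + Σ cp`, `μO⁰ = μO¹ + d + Σ cm`.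
THEOREM (`egcBracket_eq_transition_form`): with `Δ_X = cm_X − cp_X`,
  `β_e = β'_e + (cs_P·Δ_QΔ_D + cs_Q·Δ_PΔ_D + cs_D·Δ_PΔ_Q)`,
  `β'_e = Σ_{pairs} cp cp'(1 − (1−p)cm'') + Σ_{pairs} cm cm'(1 − p·cp'') + Σ_X cp_X cm_X + (2−p)·cp_P cp_Q cp_D + (1+p)·cm_P cm_Q cm_D + d² + d(Σcp + Σcm)`
and `β'_e ≥ 0` (`bracketPos_nonneg`; masses in `[0,1]`).  COROLLARY (`egcBracket_nonneg_of_static_zero`): if at `e` no petal has static mass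
(`cs_P = cs_Q = cs_D = 0`, i.e. `e` is pivotal towards the core for every petal configuration with `e` absent) then `β_e ≥ 0` — so the
only obstruction to the one-coordinate step for S₃ is STATIC petal mass times opposite-sign changes of the two other petals
(`−cs_k(cm_i cp_j + cp_i cm_j)`).  HONEST FRAMING: an exact localisation of the obstruction; EGC / S₃ / the class law remain OPEN. [this work]
-/

noncomputable section

open scoped Classical

namespace Summit.CriticalPhenomena.PercolationContinuityZ3.Theorems

namespace SahiDeepCore

open Finset Function
open Literature.Combinatorics.Sahi2008
open Literature.Probability.Percolation.DecisionTree (ind ind_of_mem ind_of_not_mem ind_nonneg)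

variable {ι : Type} [Fintype ι]

local notation3 (prettyPrint := false) "m⟦" p ", " X "⟧" => ex (bernoulliWeight p) (ind X)

/-! ### 1. Algebra: the transition form of the bracket and its sign -/

/-- **The bracket in transition variables (pure algebra).**  Substituting the bookkeeping relations into `egcBracket`'s section-mass
formula gives `β' + static term`. [this work] -/
theorem bracket_transition_identity (q k0 o1 csP csQ csD cpP cpQ cpD cmP cmQ cmD dd : ℝ) :
    ((k0 + dd + cpP + cpQ + cpD) - k0) * ((o1 + dd + cmP + cmQ + cmD) - o1)
      + (((csP + cmP) - (csP + cpP)) * ((csQ + cmQ) - (csQ + cpQ)) + ((csP + cmP) - (csP + cpP)) * ((csD + cmD) - (csD + cpD))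
         + ((csQ + cmQ) - (csQ + cpQ)) * ((csD + cmD) - (csD + cpD)))
      + (((csP + cmP) - (csP + cpP)) * ((csQ + cmQ) - (csQ + cpQ)) * (csD + cpD)
         + ((csP + cmP) - (csP + cpP)) * ((csD + cmD) - (csD + cpD)) * (csQ + cpQ)
         + ((csQ + cmQ) - (csQ + cpQ)) * ((csD + cmD) - (csD + cpD)) * (csP + cpP))
      + (1 + q) * (((csP + cmP) - (csP + cpP)) * ((csQ + cmQ) - (csQ + cpQ)) * ((csD + cmD) - (csD + cpD)))
    = (cpP * cpQ * (1 - (1 - q) * cmD) + cpP * cpD * (1 - (1 - q) * cmQ) + cpQ * cpD * (1 - (1 - q) * cmP)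
        + cmP * cmQ * (1 - q * cpD) + cmP * cmD * (1 - q * cpQ) + cmQ * cmD * (1 - q * cpP)
        + (cpP * cmP + cpQ * cmQ + cpD * cmD) + (2 - q) * (cpP * cpQ * cpD) + (1 + q) * (cmP * cmQ * cmD)
        + dd ^ 2 + dd * (cpP + cpQ + cpD + cmP + cmQ + cmD))
      + (csP * ((cmQ - cpQ) * (cmD - cpD)) + csQ * ((cmP - cpP) * (cmD - cpD)) + csD * ((cmP - cpP) * (cmQ - cpQ))) := by
  ring

/-- **`β' ≥ 0`**: every term of the transition form except the static one is nonnegative when the masses lie in `[0,1]` and `p_e ∈ [0,1]`.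
[this work] -/
theorem bracketPos_nonneg {q cpP cpQ cpD cmP cmQ cmD dd : ℝ} (hq0 : 0 ≤ q) (hq1 : q ≤ 1)
    (h1 : 0 ≤ cpP) (h2 : 0 ≤ cpQ) (h3 : 0 ≤ cpD) (h4 : 0 ≤ cmP) (h5 : 0 ≤ cmQ) (h6 : 0 ≤ cmD) (h7 : 0 ≤ dd)
    (u1 : cpP ≤ 1) (u2 : cpQ ≤ 1) (u3 : cpD ≤ 1) (u4 : cmP ≤ 1) (u5 : cmQ ≤ 1) (u6 : cmD ≤ 1) :
    0 ≤ cpP * cpQ * (1 - (1 - q) * cmD) + cpP * cpD * (1 - (1 - q) * cmQ) + cpQ * cpD * (1 - (1 - q) * cmP)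
        + cmP * cmQ * (1 - q * cpD) + cmP * cmD * (1 - q * cpQ) + cmQ * cmD * (1 - q * cpP)
        + (cpP * cmP + cpQ * cmQ + cpD * cmD) + (2 - q) * (cpP * cpQ * cpD) + (1 + q) * (cmP * cmQ * cmD)
        + dd ^ 2 + dd * (cpP + cpQ + cpD + cmP + cmQ + cmD) := by
  have a1 : 0 ≤ 1 - (1 - q) * cmD := by nlinarith
  have a2 : 0 ≤ 1 - (1 - q) * cmQ := by nlinarith
  have a3 : 0 ≤ 1 - (1 - q) * cmP := by nlinarith
  have b1 : 0 ≤ 1 - q * cpD := by nlinarith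
  have b2 : 0 ≤ 1 - q * cpQ := by nlinarith
  have b3 : 0 ≤ 1 - q * cpP := by nlinarith
  have t1 := mul_nonneg (mul_nonneg h1 h2) a1
  have t2 := mul_nonneg (mul_nonneg h1 h3) a2
  have t3 := mul_nonneg (mul_nonneg h2 h3) a3
  have t4 := mul_nonneg (mul_nonneg h4 h5) b1
  have t5 := mul_nonneg (mul_nonneg h4 h6) b2
  have t6 := mul_nonneg (mul_nonneg h5 h6) b3
  have t7 := mul_nonneg h1 h4; have t8 := mul_nonneg h2 h5; have t9 := mul_nonneg h3 h6
  have t10 := mul_nonneg (show (0:ℝ) ≤ 2 - q by linarith) (mul_nonneg (mul_nonneg h1 h2) h3)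
  have t11 := mul_nonneg (show (0:ℝ) ≤ 1 + q by linarith) (mul_nonneg (mul_nonneg h4 h5) h6)
  have t12 := sq_nonneg dd
  have t13 := mul_nonneg h7 (show 0 ≤ cpP + cpQ + cpD + cmP + cmQ + cmD by linarith)
  linarith

/-! ### 2. The bracket in transition form, and the static-free corollary -/

/-- **THEOREM (transition form of the bracket).**  For a sandwiched increasing triple and any coordinate `e`,
`β_e = β'_e + (cs_P Δ_QΔ_D + cs_Q Δ_PΔ_D + cs_D Δ_PΔ_Q)` with `β'_e` the manifestly nonnegative expression of `bracketPos_nonneg`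
(all masses = `μ_p` of intersections of sections; notation in the module docstring). [this work] -/
theorem egcBracket_eq_transition_form (p : ι → unitInterval) (e : ι) {A B N : Set (Set ι)} (hA : IsUpperSet A) (hB : IsUpperSet B)
    (hN : IsUpperSet N) (hAB : A \ B ⊆ N) (hBA : B \ A ⊆ N) :
    egcBracket p e A B N =
      (m⟦p, secAt e false (A \ B) ∩ secAt e true (A ∩ B ∩ N)⟧ * m⟦p, secAt e false (B \ A) ∩ secAt e true (A ∩ B ∩ N)⟧
            * (1 - (1 - (p e : ℝ)) * m⟦p, secAt e false (A ∪ B)ᶜ ∩ secAt e true ((A ∩ B) \ N)⟧)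
        + m⟦p, secAt e false (A \ B) ∩ secAt e true (A ∩ B ∩ N)⟧ * m⟦p, secAt e false ((A ∩ B) \ N) ∩ secAt e true (A ∩ B ∩ N)⟧
            * (1 - (1 - (p e : ℝ)) * m⟦p, secAt e false (A ∪ B)ᶜ ∩ secAt e true (B \ A)⟧)
        + m⟦p, secAt e false (B \ A) ∩ secAt e true (A ∩ B ∩ N)⟧ * m⟦p, secAt e false ((A ∩ B) \ N) ∩ secAt e true (A ∩ B ∩ N)⟧
            * (1 - (1 - (p e : ℝ)) * m⟦p, secAt e false (A ∪ B)ᶜ ∩ secAt e true (A \ B)⟧)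
        + m⟦p, secAt e false (A ∪ B)ᶜ ∩ secAt e true (A \ B)⟧ * m⟦p, secAt e false (A ∪ B)ᶜ ∩ secAt e true (B \ A)⟧
            * (1 - (p e : ℝ) * m⟦p, secAt e false ((A ∩ B) \ N) ∩ secAt e true (A ∩ B ∩ N)⟧)
        + m⟦p, secAt e false (A ∪ B)ᶜ ∩ secAt e true (A \ B)⟧ * m⟦p, secAt e false (A ∪ B)ᶜ ∩ secAt e true ((A ∩ B) \ N)⟧
            * (1 - (p e : ℝ) * m⟦p, secAt e false (B \ A) ∩ secAt e true (A ∩ B ∩ N)⟧)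
        + m⟦p, secAt e false (A ∪ B)ᶜ ∩ secAt e true (B \ A)⟧ * m⟦p, secAt e false (A ∪ B)ᶜ ∩ secAt e true ((A ∩ B) \ N)⟧
            * (1 - (p e : ℝ) * m⟦p, secAt e false (A \ B) ∩ secAt e true (A ∩ B ∩ N)⟧)
        + (m⟦p, secAt e false (A \ B) ∩ secAt e true (A ∩ B ∩ N)⟧ * m⟦p, secAt e false (A ∪ B)ᶜ ∩ secAt e true (A \ B)⟧
            + m⟦p, secAt e false (B \ A) ∩ secAt e true (A ∩ B ∩ N)⟧ * m⟦p, secAt e false (A ∪ B)ᶜ ∩ secAt e true (B \ A)⟧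
            + m⟦p, secAt e false ((A ∩ B) \ N) ∩ secAt e true (A ∩ B ∩ N)⟧ * m⟦p, secAt e false (A ∪ B)ᶜ ∩ secAt e true ((A ∩ B) \ N)⟧)
        + (2 - (p e : ℝ)) * (m⟦p, secAt e false (A \ B) ∩ secAt e true (A ∩ B ∩ N)⟧ * m⟦p, secAt e false (B \ A) ∩ secAt e true (A ∩ B ∩ N)⟧
            * m⟦p, secAt e false ((A ∩ B) \ N) ∩ secAt e true (A ∩ B ∩ N)⟧)
        + (1 + (p e : ℝ)) * (m⟦p, secAt e false (A ∪ B)ᶜ ∩ secAt e true (A \ B)⟧ * m⟦p, secAt e false (A ∪ B)ᶜ ∩ secAt e true (B \ A)⟧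
            * m⟦p, secAt e false (A ∪ B)ᶜ ∩ secAt e true ((A ∩ B) \ N)⟧)
        + m⟦p, secAt e false (A ∪ B)ᶜ ∩ secAt e true (A ∩ B ∩ N)⟧ ^ 2
        + m⟦p, secAt e false (A ∪ B)ᶜ ∩ secAt e true (A ∩ B ∩ N)⟧ *
            (m⟦p, secAt e false (A \ B) ∩ secAt e true (A ∩ B ∩ N)⟧ + m⟦p, secAt e false (B \ A) ∩ secAt e true (A ∩ B ∩ N)⟧
              + m⟦p, secAt e false ((A ∩ B) \ N) ∩ secAt e true (A ∩ B ∩ N)⟧ + m⟦p, secAt e false (A ∪ B)ᶜ ∩ secAt e true (A \ B)⟧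
              + m⟦p, secAt e false (A ∪ B)ᶜ ∩ secAt e true (B \ A)⟧ + m⟦p, secAt e false (A ∪ B)ᶜ ∩ secAt e true ((A ∩ B) \ N)⟧))
      + (m⟦p, secAt e false (A \ B) ∩ secAt e true (A \ B)⟧ *
            ((m⟦p, secAt e false (A ∪ B)ᶜ ∩ secAt e true (B \ A)⟧ - m⟦p, secAt e false (B \ A) ∩ secAt e true (A ∩ B ∩ N)⟧)
              * (m⟦p, secAt e false (A ∪ B)ᶜ ∩ secAt e true ((A ∩ B) \ N)⟧ - m⟦p, secAt e false ((A ∩ B) \ N) ∩ secAt e true (A ∩ B ∩ N)⟧))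
        + m⟦p, secAt e false (B \ A) ∩ secAt e true (B \ A)⟧ *
            ((m⟦p, secAt e false (A ∪ B)ᶜ ∩ secAt e true (A \ B)⟧ - m⟦p, secAt e false (A \ B) ∩ secAt e true (A ∩ B ∩ N)⟧)
              * (m⟦p, secAt e false (A ∪ B)ᶜ ∩ secAt e true ((A ∩ B) \ N)⟧ - m⟦p, secAt e false ((A ∩ B) \ N) ∩ secAt e true (A ∩ B ∩ N)⟧))
        + m⟦p, secAt e false ((A ∩ B) \ N) ∩ secAt e true ((A ∩ B) \ N)⟧ *
            ((m⟦p, secAt e false (A ∪ B)ᶜ ∩ secAt e true (A \ B)⟧ - m⟦p, secAt e false (A \ B) ∩ secAt e true (A ∩ B ∩ N)⟧)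
              * (m⟦p, secAt e false (A ∪ B)ᶜ ∩ secAt e true (B \ A)⟧ - m⟦p, secAt e false (B \ A) ∩ secAt e true (A ∩ B ∩ N)⟧))) := by
  -- bookkeeping (petal `B ∖ A` is the petal `A ∖ B` of the swapped triple)
  have hN' : N ⊆ N := le_rfl
  have hP0 := petal_section_false p e hA hN hAB
  have hP1 := petal_section_true p e hA hB hN hBA
  have hQ0 := petal_section_false p e (A := B) (B := A) hB hN hBA
  have hQ1 := petal_section_true p e (A := B) (B := A) hB hA hN hAB
  rw [Set.inter_comm B A] at hQ0
  rw [Set.union_comm B A] at hQ1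
  have hD0 := dpetal_section_false p e (N := N) hA hB
  have hD1 := dpetal_section_true p e hA hB hN hAB hBA
  have hK1 := core_section_true p e (N := N) hA hB hN
  have hO0 := outside_section_false p e (N := N) hA hB
  have _ := hN'
  simp only [egcBracket]
  rw [hP0, hP1, hQ0, hQ1, hD0, hD1, hK1, hO0]
  ring

/-- **COROLLARY (a static-free coordinate is good).**  If at the coordinate `e` no petal configuration stays in its petal when `e` is
raised (`cs_P = cs_Q = cs_D = 0`), then `β_e ≥ 0`. [this work] -/
theorem egcBracket_nonneg_of_static_zero (p : ι → unitInterval) (e : ι) {A B N : Set (Set ι)} (hA : IsUpperSet A) (hB : IsUpperSet B)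
    (hN : IsUpperSet N) (hAB : A \ B ⊆ N) (hBA : B \ A ⊆ N)
    (hsP : m⟦p, secAt e false (A \ B) ∩ secAt e true (A \ B)⟧ = 0) (hsQ : m⟦p, secAt e false (B \ A) ∩ secAt e true (B \ A)⟧ = 0)
    (hsD : m⟦p, secAt e false ((A ∩ B) \ N) ∩ secAt e true ((A ∩ B) \ N)⟧ = 0) :
    0 ≤ egcBracket p e A B N := by
  rw [egcBracket_eq_transition_form p e hA hB hN hAB hBA, hsP, hsQ, hsD]
  have h0 : ∀ X : Set (Set ι), 0 ≤ m⟦p, X⟧ := fun X => ex_nonneg (isFKGMeasure_bernoulliWeight p).nonneg fun ω => ind_nonneg _ ω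
  have h1 : ∀ X : Set (Set ι), m⟦p, X⟧ ≤ 1 := fun X => ex_bernoulliWeight_ind_le_one p X
  have hb := bracketPos_nonneg (q := (p e : ℝ)) (p e).2.1 (p e).2.2
    (h0 (secAt e false (A \ B) ∩ secAt e true (A ∩ B ∩ N))) (h0 (secAt e false (B \ A) ∩ secAt e true (A ∩ B ∩ N)))
    (h0 (secAt e false ((A ∩ B) \ N) ∩ secAt e true (A ∩ B ∩ N))) (h0 (secAt e false (A ∪ B)ᶜ ∩ secAt e true (A \ B)))
    (h0 (secAt e false (A ∪ B)ᶜ ∩ secAt e true (B \ A))) (h0 (secAt e false (A ∪ B)ᶜ ∩ secAt e true ((A ∩ B) \ N)))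
    (h0 (secAt e false (A ∪ B)ᶜ ∩ secAt e true (A ∩ B ∩ N)))
    (h1 _) (h1 _) (h1 _) (h1 _) (h1 _) (h1 _)
  linarith

end SahiDeepCore

end Summit.CriticalPhenomena.PercolationContinuityZ3.Theorems
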